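import Summits.HodgeConjecture.HodgeConjecture.Theses.HeckePrymWeil
import Literature.AlgebraicGeometry.HodgeTheory.HodgeLocus
import Literature.AlgebraicGeometry.HodgeTheory.WeilClassesFourfoldsProofs

/-!
# Crux-ideate sketch — `HeckePrymAnchors` (stmt-HodgeConjecture-14496), ideator 2, round 1

First lemmas of the two idea cards, typed over existing declarations, plus the kernel-checked
composition showing that the proposed line concludes the crux BY NAME:

* card `landherr-split-anchor`: `typedWeilPlane`, `companion` (`√-p` on `A₀ × A₀` as the companion
  matrix of `X² + p`), `WeilSurfaceGuard`, `LandherrSplit` (a fibre `K`-isogenous to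
  `(A₀ ⊗_ℚ K) × B`), the four anchor stubs `PointClassAnchor` (FIRST LEMMA: Deligne LNM 900
  Lemma 4.5 / Remark 4.10 in typed form), `SurfaceBase`, `SurfaceProductStep`, `IsogenyTransfer`,
  the composition `anchorAlgebraic_of`, the reach stub `SplitReach`, `IsoTransport` (proved from
  the route's `IsoInvariance`), and the glue `heckePrymAnchors_of`.
* card `isotypic-leray-edge`: `IsotypicLerayEdge` — for a smooth projective family carrying a
  fibre-preserving endomorphism acting by `N^i` on `Hⁱ` of every fibre (an abelian scheme and `[N]`),
  every continuous section of the étalé space `FiberClass f j` of `Rʲ f_* ℂ` is the restriction of ONE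
  global class on the OPEN total space (Leray degenerates by weights; no compactification, no Hodge II);
  variant `AffineCurveEdge`.
-/

noncomputable section

open CategoryTheory AlgebraicGeometry

namespace Summit.HodgeConjecture.HodgeConjecture.Cruxes.HeckePrymAnchors.IdeatorTwo

open Literature.AlgebraicGeometry Literature.AlgebraicGeometry.Motives
  Literature.AlgebraicGeometry.HodgeTheory
open Summit.HodgeConjecture.HodgeConjecture.Theses.HeckePrymWeil

/-- The route's TYPED Weil plane of `(A, φ)` in degree `2k` for `K = ℚ(√-p)`:
`Eig((𝟙+φ)^*, (1+i√p)^{2k}) ⊔ Eig((𝟙+φ)^*, (1-i√p)^{2k}) ⊆ H^{2k}(A(ℂ); ℂ)` — literally the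
expression of `HeckePrymAnchors` / `HodgeWeilLadder` (reducible, so memberships unify). -/
abbrev typedWeilPlane (A : AbelianVariety ℂ) (φ : A ⟶ A) (k p : ℕ) :
    Submodule ℂ (complexBetti A.X (2 * k)) :=
  Module.End.eigenspace (complexBetti.map (𝟙 A + φ).hom.hom.hom (2 * k)).hom
      ((1 + Complex.I * (Real.sqrt (p : ℝ) : ℂ)) ^ (2 * k)) ⊔
    Module.End.eigenspace (complexBetti.map (𝟙 A + φ).hom.hom.hom (2 * k)).hom
      ((1 - Complex.I * (Real.sqrt (p : ℝ) : ℂ)) ^ (2 * k))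

/-- **`A₀ ⊗_ℚ K` (Deligne LNM 900, proof of Thm 4.8):** multiplication by `√-p` on `A₀ × A₀` is the
companion matrix of `X² + p`, `(x, y) ↦ (-p·y, x)`, for ANY abelian variety `A₀`. -/
def companion (A₀ : AbelianVariety ℂ) (p : ℕ) : A₀.prod A₀ ⟶ A₀.prod A₀ :=
  AbelianVariety.prodLift (AbelianVariety.snd A₀ A₀ ≫ (-((p : ℤ) • 𝟙 A₀)))
    (AbelianVariety.fst A₀ A₀)

/-- `companion² = -p` (so `(A₀ × A₀, companion)` is in the crux's sector, of signature `(k₀,k₀)`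
automatically). -/
theorem companion_comp_companion (A₀ : AbelianVariety ℂ) (p : ℕ) :
    companion A₀ p ≫ companion A₀ p = -((p : ℤ) • 𝟙 (A₀.prod A₀)) := by
  apply AbelianVariety.prod_hom_ext
  · rw [Category.assoc, companion, AbelianVariety.prodLift_fst, ← Category.assoc,
      AbelianVariety.prodLift_snd]
    simp [Preadditive.comp_neg, Preadditive.neg_comp]
  · rw [Category.assoc, companion, AbelianVariety.prodLift_snd, AbelianVariety.prodLift_fst]
    simp [Preadditive.comp_neg, Preadditive.neg_comp]

/-- The crux's guard on the surface factor: a non-zero RATIONAL class of type `(1,1)` in the typed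
Weil plane of `(B, ψ)` (forces signature `(1,1)`). Literally the crux's clause. -/
def WeilSurfaceGuard (B : AbelianVariety ℂ) (ψ : B ⟶ B) (p : ℕ) : Prop :=
  ∃ b : complexBetti B.X (2 * 1), b ≠ 0 ∧ IsRationalClass b ∧
    IsOfHodgeType (2 * 1) B.X (2 * 1) 1 1 b ∧ b ∈ typedWeilPlane B ψ 1 p

/-- Stub WS (classical; Lean: the tree constructs no positive-dimensional abelian variety yet):
a Weil surface for `ℚ(√-p)` exists — `E × E` for ANY elliptic curve `E` with `ψ = companion E p`
(signature `(1,1)` automatic, no CM needed), or `E_K × E_K` with `(ι, -ι)`. -/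
def WeilSurfaceExists : Prop :=
  ∀ p : ℕ, p.Prime → p % 4 = 3 → 7 ≤ p →
    ∃ (B : AbelianVariety ℂ) (ψ : B ⟶ B), B.dim = 2 ∧ ψ ≫ ψ = -((p : ℤ) • 𝟙 B) ∧
      WeilSurfaceGuard B ψ p

/-- **Landherr-split Weil-type varieties** (the anchor class of the card). Landherr's normal form
`H ≅ diag(a, 1, …, 1, -1, …, -1) = hyp^{k-1} ⊥ ⟨a, -1⟩` (van Geemen LNM 1594 §5.4) read on the
lattice of `X` itself: the Weil family through `X` has a fibre `Y` that is `K`-isogenous to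
`(A₀ × A₀, companion) × (B, ψ)` with `A₀` ANY abelian `(k-1)`-fold (Deligne LNM 900, proof of
Thm 4.8: `A₀ ⊗_ℚ K` realises the split form `hyp^{k-1}`) and `(B, ψ)` a signature-(1,1) Weil surface
realising `⟨a, -1⟩`. -/
def LandherrSplit (p k : ℕ) (Y : AbelianVariety ℂ) (Ψ : Y ⟶ Y) : Prop :=
  ∃ (k₀ : ℕ) (A₀ B : AbelianVariety ℂ) (ψ : B ⟶ B)
    (f : Y ⟶ (A₀.prod A₀).prod B) (g : (A₀.prod A₀).prod B ⟶ Y) (m : ℕ),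
    k = k₀ + 1 ∧ A₀.dim = k₀ ∧ B.dim = 2 ∧ ψ ≫ ψ = -((p : ℤ) • 𝟙 B) ∧ WeilSurfaceGuard B ψ p ∧
    Y.dim = 2 * k ∧ Ψ ≫ Ψ = -((p : ℤ) • 𝟙 Y) ∧ 0 < m ∧ f ≫ g = m • 𝟙 Y ∧
    Flat f.hom.hom.hom.left ∧
    g ≫ Ψ = AbelianVariety.prodLift (AbelianVariety.fst _ B ≫ companion A₀ p)
      (AbelianVariety.snd _ B ≫ ψ) ≫ g

/-- **FIRST LEMMA of card `landherr-split-anchor` — Stub A1, Deligne's split anchor in typed form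
(LNM 900, Lemma 4.5 and Remark 4.10, used for ALGEBRAICITY rather than absoluteness):** for ANY
abelian variety `A₀` of dimension `k₀`, the typed Weil plane of `(A₀ × A₀, companion)` in degree
`2k₀` consists of algebraic classes. Reason: `H¹(A₀ × A₀) = H¹(A₀) ⊗ ℚ²` with `√-p` acting on `ℚ²`;
`V₊ = H¹(A₀) ⊗ e₊`, so `Eig₊ = ⋀^{2k₀}V₊ = det H¹(A₀) ⊗ e₊^{2k₀}` is a point of the Veronese curve
`v ↦ ⋀^{2k₀}(H¹(A₀) ⊗ v) = (u·pr₁ + v·pr₂)^*[pt]`, `(u,v) ∈ ℚ²` Zariski dense: the typed plane lies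
in the `ℂ`-span of the classes `(u • fst + v • snd)^*[pt_{A₀}]`, `(u,v) ≠ 0`, i.e. of the classes of
the abelian subvarieties `ker(u·pr₁ + v·pr₂) ≅ A₀` — pull-backs of the POINT class (top degree:
`algebraicClasses A₀.X k₀ = ⊤`) along flat surjective homomorphisms
(`map_mem_algebraicClasses_of_flat`). No Lefschetz (1,1), no Hodge ring, no CM. -/
def PointClassAnchor : Prop :=
  ∀ p : ℕ, p.Prime → p % 4 = 3 → 7 ≤ p → ∀ (k₀ : ℕ) (A₀ : AbelianVariety ℂ), A₀.dim = k₀ →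
    typedWeilPlane (A₀.prod A₀) (companion A₀ p) k₀ p ≤ algebraicClasses (A₀.prod A₀).X k₀

/-- The finer statement behind `PointClassAnchor` (same card): the typed plane is inside the span of
the pull-backs of top-degree classes of `A₀` along the homomorphisms `u·pr₁ + v·pr₂`. -/
def PointClassSpan : Prop :=
  ∀ (p k₀ : ℕ) (A₀ : AbelianVariety ℂ), A₀.dim = k₀ →
    typedWeilPlane (A₀.prod A₀) (companion A₀ p) k₀ p ≤
      ⨆ uv : ℤ × ℤ, Submodule.map
        (complexBetti.map
          (uv.1 • AbelianVariety.fst A₀ A₀ + uv.2 • AbelianVariety.snd A₀ A₀).hom.hom.hom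
          (2 * k₀)).hom ⊤

/-- Stub A0 (base; Lefschetz (1,1) on ONE abelian surface, or graph divisors when `B = E₁ × E₂` is
the CM point): the typed Weil plane of a signature-(1,1) Weil surface consists of algebraic classes
(it is the `ℂ`-span of its rational points, which are rational `(1,1)` classes). -/
def SurfaceBase : Prop :=
  ∀ p : ℕ, p.Prime → p % 4 = 3 → 7 ≤ p → ∀ (B : AbelianVariety ℂ) (ψ : B ⟶ B),
    B.dim = 2 → ψ ≫ ψ = -((p : ℤ) • 𝟙 B) → WeilSurfaceGuard B ψ p →
      typedWeilPlane B ψ 1 p ≤ algebraicClasses B.X 1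

/-- Stub A2, ONE product step in the anchor direction (determinant multiplicativity
`⋀^{2n+2}_K(V_A ⊕ V_B) = ⋀^{2n}_K V_A ⊗_K ⋀²_K V_B`): if the typed Weil planes of a `2n`-fold
`(A, φ)` and of a surface `(B, ψ)` consist of algebraic classes, so does that of `(A × B, φ × ψ)` in
degree `2n+2`: by eigenvalue separation (`Negative/LadderTyping.one_add_I_sqrt_pow_ne`) and
`H^• = ⋀^•H¹` + Künneth, `Eig₊(A × B) = Eig₊(A) ⊠ Eig₊(B)` is ONE line spanned by the exterior
product of the eigen-lines, algebraic by the tree's PROVED `cupProduct_map_fst_map_snd_mem_algebraicClasses`. -/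
def SurfaceProductStep : Prop :=
  ∀ p : ℕ, p.Prime → p % 4 = 3 → 7 ≤ p → ∀ (n : ℕ) (A : AbelianVariety ℂ) (φ : A ⟶ A)
    (B : AbelianVariety ℂ) (ψ : B ⟶ B),
    A.dim = 2 * n → B.dim = 2 → φ ≫ φ = -((p : ℤ) • 𝟙 A) → ψ ≫ ψ = -((p : ℤ) • 𝟙 B) →
    typedWeilPlane A φ n p ≤ algebraicClasses A.X n →
    typedWeilPlane B ψ 1 p ≤ algebraicClasses B.X 1 →
      typedWeilPlane (A.prod B)
          (AbelianVariety.prodLift (AbelianVariety.fst A B ≫ φ) (AbelianVariety.snd A B ≫ ψ))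
          (n + 1) p ≤ algebraicClasses (A.prod B).X (n + 1)

/-- Stub A3 (isogeny transfer of the typed plane, pattern of the tree's PROVED
`mem_algebraicClasses_of_isogeny_of_mem_weilClassesOf`): `g^*` maps the typed plane of `Y` into that
of `Y'` (equivariance), which is algebraic; `f^* g^* = (m·𝟙)^* = m^{2k}` on `H^{2k}` and flat
pull-back preserves algebraic classes. -/
def IsogenyTransfer : Prop :=
  ∀ (p k : ℕ) (Y Y' : AbelianVariety ℂ) (Ψ : Y ⟶ Y) (Ψ' : Y' ⟶ Y'),
    Y.dim = 2 * k → Ψ ≫ Ψ = -((p : ℤ) • 𝟙 Y) →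
    ∀ (f : Y ⟶ Y') (g : Y' ⟶ Y) (m : ℕ), 0 < m → f ≫ g = m • 𝟙 Y → Flat f.hom.hom.hom.left →
      g ≫ Ψ = Ψ' ≫ g → typedWeilPlane Y' Ψ' k p ≤ algebraicClasses Y'.X k →
        typedWeilPlane Y Ψ k p ≤ algebraicClasses Y.X k

/-- The anchor theorem of the card: Landherr-split Weil-type varieties have algebraic typed Weil
planes. -/
def AnchorAlgebraic : Prop :=
  ∀ p : ℕ, p.Prime → p % 4 = 3 → 7 ≤ p → ∀ (k : ℕ) (Y : AbelianVariety ℂ) (Ψ : Y ⟶ Y),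
    LandherrSplit p k Y Ψ → typedWeilPlane Y Ψ k p ≤ algebraicClasses Y.X k

/-- **The anchor theorem is the four stubs** (kernel-checked composition). -/
theorem anchorAlgebraic_of (h1 : PointClassAnchor) (h0 : SurfaceBase) (h2 : SurfaceProductStep)
    (h3 : IsogenyTransfer) : AnchorAlgebraic := by
  intro p hp hp4 hp7 k Y Ψ h
  obtain ⟨k₀, A₀, B, ψ, f, g, m, hk, hA₀, hB, hψ, hguard, hY, hΨ, hm, hfg, hf, hg⟩ := h
  subst hk
  have hprod : typedWeilPlane ((A₀.prod A₀).prod B)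
      (AbelianVariety.prodLift (AbelianVariety.fst _ B ≫ companion A₀ p)
        (AbelianVariety.snd _ B ≫ ψ)) (k₀ + 1) p ≤
      algebraicClasses ((A₀.prod A₀).prod B).X (k₀ + 1) :=
    h2 p hp hp4 hp7 k₀ (A₀.prod A₀) (companion A₀ p) B ψ
      (by rw [AbelianVariety.dim_prod, hA₀, two_mul]) hB (companion_comp_companion A₀ p) hψ
      (h1 p hp hp4 hp7 k₀ A₀ hA₀) (h0 p hp hp4 hp7 B ψ hB hψ hguard)
  exact h3 p (k₀ + 1) Y _ Ψ _ hY hΨ f g m hm hfg hf hg hprod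

/-- Stub R (REACH with a Landherr-split fibre; classical moduli theory — van Geemen LNM 1594
§5.3–5.11, Deligne LNM 900 proof of Thm 4.8 (pp. 47–52 of the volume); Lean XL): every Weil-type
`(X, Φ)` of dimension `2k` and every rational `(k,k)` class `c` of its typed Weil plane sit in a
smooth projective family of Weil-type abelian `2k`-folds over a smooth irreducible base
(`Γ \ X⁺`, level `n ≥ 3`), `c = W|_{s₁}` for a global class `W` that is fibrewise a rational `(k,k)`
class (the flat Weil section — `det_K γ ≡ 1 (mod n)` forces `det_K γ = 1` — globalised over the OPEN
base by `IsotypicLerayEdge` / Voisin II Thm 4.18, not by Hodge II), and SOME fibre `s₀` is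
Landherr-split with `W|_{s₀}` in its typed plane (`V₊` chosen on the SAME lattice: no discriminant
bookkeeping, every component). -/
def SplitReach : Prop :=
  ∀ p : ℕ, p.Prime → p % 4 = 3 → 7 ≤ p → ∀ (k : ℕ) (X : AbelianVariety ℂ) (Φ : X ⟶ X),
    X.dim = 2 * k → Φ ≫ Φ = -((p : ℤ) • 𝟙 X) →
    ∀ c : complexBetti X.X (2 * k), IsRationalClass c → IsOfHodgeType (2 * k) X.X (2 * k) k k c →
      c ∈ typedWeilPlane X Φ k p →
      ∃ (𝒳 S : SchemeOver ℂ) (f : 𝒳 ⟶ S) (s₁ s₀ : ComplexPoints S) (e : X.X ≅ fiberOver f s₁)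
        (W : complexBetti 𝒳 (2 * k)),
        IsSmoothProjectiveFamily f (2 * k) ∧ IrreducibleSpace S.left ∧ Smooth S.hom ∧
        (∀ s : ComplexPoints S,
          IsRationalClass (complexBetti.map (fiberι f s) (2 * k) W) ∧
          IsOfHodgeType (2 * k) (fiberOver f s) (2 * k) k k
            (complexBetti.map (fiberι f s) (2 * k) W)) ∧
        (∀ s : ComplexPoints S, ∃ (A' : AbelianVariety ℂ) (φ' : A' ⟶ A'), A'.dim = 2 * k ∧
          φ' ≫ φ' = -((p : ℤ) • 𝟙 A') ∧ Nonempty (A'.X ≅ fiberOver f s)) ∧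
        complexBetti.map e.hom (2 * k) (complexBetti.map (fiberι f s₁) (2 * k) W) = c ∧
        ∃ (Y : AbelianVariety ℂ) (Ψ : Y ⟶ Y) (e₀ : Y.X ≅ fiberOver f s₀),
          LandherrSplit p k Y Ψ ∧
          complexBetti.map e₀.hom (2 * k) (complexBetti.map (fiberι f s₀) (2 * k) W) ∈
            typedWeilPlane Y Ψ k p

/-- Transport of algebraicity BACK along an isomorphism onto a fibre (a consequence of the route's
support item `IsoInvariance` and functoriality, proved below). -/
def IsoTransport : Prop :=
  ∀ (F : SchemeOver ℂ) (Y : AbelianVariety ℂ) (e₀ : Y.X ≅ F) (k : ℕ) (x : complexBetti F (2 * k)),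
    complexBetti.map e₀.hom (2 * k) x ∈ algebraicClasses Y.X k → x ∈ algebraicClasses F k

theorem isoTransport_of_isoInvariance (h : IsoInvariance) : IsoTransport := by
  intro F Y e₀ k x hx
  have h' := h e₀.symm k (complexBetti.map e₀.hom (2 * k) x) hx
  have hcomp : complexBetti.map e₀.symm.hom (2 * k) (complexBetti.map e₀.hom (2 * k) x) = x := by
    rw [← CategoryTheory.comp_apply, ← complexBetti.map_comp, Iso.symm_hom, Iso.inv_hom_id,
      complexBetti.map_id, CategoryTheory.id_apply]
  rwa [hcomp] at h'

/-- **GLUE (kernel-checked): the line concludes the crux `HeckePrymAnchors` BY NAME.** -/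
theorem heckePrymAnchors_of (hWS : WeilSurfaceExists) (hR : SplitReach) (hA : AnchorAlgebraic)
    (hI : IsoTransport) : HeckePrymAnchors := by
  intro p hp hp4 hp7 g hg n k hk hkg A φ hAdim hφ
  obtain ⟨B, ψ, hB, hψ, hguard⟩ := hWS p hp hp4 hp7
  refine ⟨B, ψ, hB, hψ, hguard, ?_⟩
  intro c hc hcH hcW
  -- the product is a Weil-type 2k-fold
  have hφ' : φ ≫ φ = -(p • 𝟙 A) := by rw [hφ, natCast_zsmul]
  have hψ' : ψ ≫ ψ = -(p • 𝟙 B) := by rw [hψ, natCast_zsmul]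
  have hΦ : AbelianVariety.prodLift (AbelianVariety.fst A B ≫ φ) (AbelianVariety.snd A B ≫ ψ) ≫
      AbelianVariety.prodLift (AbelianVariety.fst A B ≫ φ) (AbelianVariety.snd A B ≫ ψ) =
      -((p : ℤ) • 𝟙 (A.prod B)) := by
    rw [prodLift_comp_self_eq_neg_nsmul hφ' hψ', natCast_zsmul]
  have hdim : (A.prod B).dim = 2 * k := by
    rw [hk]; exact dim_prod_eq_two_mul hAdim (by simpa using hB)
  obtain ⟨𝒳, S, f, s₁, s₀, e, W, hfam, hirr, hsm, hfib, hweil, hs₁, Y, Ψ, e₀, hsplit, hmem⟩ :=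
    hR p hp hp4 hp7 k (A.prod B) _ hdim hΦ c hc hcH hcW
  refine ⟨𝒳, S, f, s₁, s₀, e, W, hfam, hirr, hsm, hfib, hweil, hs₁, ?_⟩
  exact hI _ Y e₀ k _ (hA p hp hp4 hp7 k Y Ψ hsplit hmem)

/-- The same glue from the route's `IsoInvariance` (support item stmt-HodgeConjecture-1078) and the
four anchor stubs. -/
theorem heckePrymAnchors_of' (hWS : WeilSurfaceExists) (hR : SplitReach) (h1 : PointClassAnchor)
    (h0 : SurfaceBase) (h2 : SurfaceProductStep) (h3 : IsogenyTransfer) (hI : IsoInvariance) :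
    HeckePrymAnchors :=
  heckePrymAnchors_of hWS hR (anchorAlgebraic_of h1 h0 h2 h3) (isoTransport_of_isoInvariance hI)

/-- **FIRST LEMMA of card `isotypic-leray-edge`: weights split Leray for abelian schemes.**
For a smooth projective family `f : 𝒳 ⟶ S` with a fibre-preserving endomorphism `mulN`
(`mulN ≫ f = f`; intended: multiplication by `N ≥ 2` on an abelian scheme) acting on `Hⁱ` of every
fibre by `N^i`, every continuous section of the étalé space `FiberClass f j → S(ℂ)` of `Rʲ f_* ℂ`
(= a global flat section) is the restriction of ONE global class of the OPEN total space:
the differentials `d_r : E_r^{a,b} → E_r^{a+r,b-r+1}` of the Leray spectral sequence commute with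
`mulN^*`, which is `N^b` on the source and `N^{b-r+1}` on the target, so they vanish for `r ≥ 2`,
and the edge map `Hʲ(𝒳(ℂ); ℂ) → H⁰(S(ℂ), Rʲ f_* ℂ)` is surjective (Voisin II §4.3.1, Thm 4.18 with
Deligne's 1968 degeneration replaced by the weight argument: no hard Lefschetz either). No
compactification, no Hodge theory. -/
def IsotypicLerayEdge : Prop :=
  ∀ (𝒳 S : SchemeOver ℂ) (f : 𝒳 ⟶ S) (n j N : ℕ) (mulN : 𝒳 ⟶ 𝒳), 2 ≤ N →
    IsSmoothProjectiveFamily f n → mulN ≫ f = f →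
    (∀ (s : ComplexPoints S) (g : fiberOver f s ⟶ fiberOver f s),
        g ≫ fiberι f s = fiberι f s ≫ mulN →
        ∀ (i : ℕ) (x : complexBetti (fiberOver f s) i),
          complexBetti.map g i x = ((N : ℂ) ^ i) • x) →
    ∀ σ : ComplexPoints S → FiberClass f j, Continuous σ → (∀ s, (σ s).pt = s) →
      ∃ A : complexBetti 𝒳 j, ∀ s, σ s = globalSection f j A s

/-- Variant lever (same card): over a smooth AFFINE CURVE base every Leray differential vanishes for
dimension reasons (`S(ℂ)` is a non-compact Riemann surface, of cohomological dimension `1`), so the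
edge map is surjective for ANY smooth projective family (Voisin II Thm 4.18 needs no Lefschetz
there) — and any two points of the irreducible PEL base lie on such a curve (Mumford, Abelian
Varieties §6, Lemma; Bertini). -/
def AffineCurveEdge : Prop :=
  ∀ (𝒳 S : SchemeOver ℂ) (f : 𝒳 ⟶ S) (n j : ℕ),
    IsSmoothProjectiveFamily f n → Smooth S.hom → IsAffine S.left → IrreducibleSpace S.left →
    Motives.schemeDim S.left = 1 →
    ∀ σ : ComplexPoints S → FiberClass f j, Continuous σ → (∀ s, (σ s).pt = s) →
      ∃ A : complexBetti 𝒳 j, ∀ s, σ s = globalSection f j A s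

end Summit.HodgeConjecture.HodgeConjecture.Cruxes.HeckePrymAnchors.IdeatorTwo

end
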